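import Mathlib
import Summits.Ventures.PercRepro.TriangleCapStarFamilyWitness
import Summits.Ventures.PercRepro.TriangleCapResidueMin

/-!
# PercRepro — THE EXACT ELSE BOTTOM ON ALL GRAPHS OF THE BAND BEYOND THE THRESHOLD `m ≥ D + r − 1` (`2 r ≤ D`) /
`m ≥ D + r − 2` (`2 r > D`) (p3, gen 56; part 319)

The residue minimum of part 312, `min(2 r (D − r), 2 min(r, D − r) + φ_D(2 r))`, `r = t mod D`, evaluates to
`2 r (D − 2 r + 1)` for `2 r ≤ D` (`residue_min_half`) and to `2 ρ (D − 2 ρ + 1)`, `ρ = D − r`, for `D < 2 r < 2 D`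
(`residue_min_upper`).  THE STAR FAMILY ATTAINS IT: with `a = Rc = r`, no short row, `Q = m − r` regular columns and
`E = m + 1 − D − r` extra rows when `2 r ≤ D` and `m ≥ D + r − 1`; with `a = ρ`, `Rc = r`, the first centre row short
by `2 ρ`, `Q = m − ρ`, `E = m + 2 − D − r` when `D < 2 r` and `m ≥ D + r − 2`.  Hence on `ℓ + 1 + (s − t)` vertices,
`t = m D + r`, `m + 1 ≤ ℓ`, `2 t ≤ s`, THE BOTTOM OF THE DEEP SUB-BAND `u = t − D` ON ALL GRAPHS IS EXACTLY
`C(t,2) − t (D − 1) + r (D − 2 r + 1)` (`else_bottom_exact_half`) resp. `C(t,2) − t (D − 1) + ρ (D − 2 ρ + 1)`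
(`else_bottom_exact_upper`) — the g54 "else" formula `C(t,2) − t (D − 1) + r (D − r)` (exact on the bipartite graphs,
part 307) is beaten by `r (r − 1)` resp. `ρ (ρ − 1)` there.  Axioms: standard.
-/

namespace PercRepro

namespace TriangleCap

namespace C047

open Finset

/-- **THE RESIDUE MINIMUM FOR `2 r ≤ D`:** `min(2 r (D − r), 2 r + φ_D(2 r)) = 2 r (D − 2 r + 1)`. -/
theorem residue_min_half (D r : ℕ) (hr : 1 ≤ r) (h2 : 2 * r ≤ D) :
    min (2 * (r * (D - r))) (2 * min r (D - r) + phiD D (2 * r)) = 2 * (r * (D - 2 * r + 1)) := by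
  rw [min_eq_left (show r ≤ D - r by omega)]
  obtain ⟨u, rfl⟩ : ∃ u, D = 2 * r + u := ⟨D - 2 * r, by omega⟩
  have e1 : 2 * r + u - r = r + u := by omega
  have e2 : 2 * r + u - 2 * r = u := by omega
  rcases Nat.eq_zero_or_pos u with rfl | hu
  · rw [add_zero] at e1 e2 ⊢
    rw [phiD_self, e1, e2, add_zero, zero_add, mul_one]
    exact min_eq_right (by nlinarith [Nat.le_mul_self r])
  · rw [phiD_of_lt (2 * r + u) (2 * r) (by omega), e1, e2,
      min_eq_right (by nlinarith [Nat.le_mul_self r])]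
    ring

/-- **THE RESIDUE MINIMUM FOR `D < 2 r < 2 D`:** with `ρ = D − r`,
`min(2 r (D − r), 2 ρ + φ_D(2 r)) = 2 ρ (D − 2 ρ + 1)`. -/
theorem residue_min_upper (D r : ℕ) (h1 : D + 1 ≤ 2 * r) (h2 : r + 1 ≤ D) :
    min (2 * (r * (D - r))) (2 * min r (D - r) + phiD D (2 * r)) =
      2 * ((D - r) * (D - 2 * (D - r) + 1)) := by
  rw [min_eq_right (show D - r ≤ r by omega)]
  obtain ⟨ρ, rfl⟩ : ∃ ρ, D = r + ρ := ⟨D - r, by omega⟩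
  obtain ⟨c, rfl⟩ : ∃ c, r = ρ + c := ⟨r - ρ, by omega⟩
  have hmod : (2 * (ρ + c)) % (ρ + c + ρ) = c := by
    rw [Nat.mod_eq_sub_mod (by omega)]
    have e : 2 * (ρ + c) - (ρ + c + ρ) = c := by omega
    rw [e, Nat.mod_eq_of_lt (by omega)]
  unfold phiD
  rw [hmod]
  have e1 : ρ + c + ρ - (ρ + c) = ρ := by omega
  have e2 : ρ + c + ρ - c = 2 * ρ := by omega
  have e3 : ρ + c + ρ - 2 * ρ = c := by omega
  rw [e1, e2, e3, min_eq_right (by nlinarith)]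
  ring

/-- **THE EXACT ELSE BOTTOM FOR `2 r ≤ D` AND `m ≥ D + r − 1`, ALL GRAPHS, EVERY `ℓ`:** for `1 ≤ r`, `2 r ≤ D`,
`t = m D + r`, `D + r ≤ m + 1`, `m + 1 ≤ ℓ`, `2 t ≤ s`: every graph on `ℓ + 1 + (s − t)` vertices with a vertex of
degree `s − t` and every off-degree `≤ D` has `t (t − 1) + 2 r (D − 2 r + 1) ≤ 2 j + 2 t (D − 1)`, and the star
family attains it with maximum off-degree exactly `D` — the bottom is `C(t,2) − t (D − 1) + r (D − 2 r + 1)`. -/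
theorem else_bottom_exact_half (s ℓ m r D : ℕ) (hr : 1 ≤ r) (h2 : 2 * r ≤ D) (hm : D + r ≤ m + 1)
    (hmℓ : m + 1 ≤ ℓ) (hs : 2 * (m * D + r) ≤ s) :
    (∀ (H : SimpleGraph (Fin (ℓ + 1 + (s - (m * D + r))))) [DecidableRel H.Adj], H.CliqueFree 3 →
      H.edgeFinset.card = s → ∀ w, deg H w + (m * D + r) = s → (∀ v, offDeg H w v ≤ D) →
      ∀ j, ∑ v, deg H v * deg H v + 2 * ((m * D + r) * (s - (m * D + r) - 1)) + 2 * j = s * (s + 1) →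
      (m * D + r) * (m * D + r - 1) + 2 * (r * (D - 2 * r + 1)) ≤ 2 * j + 2 * ((m * D + r) * (D - 1))) ∧
    (∃ (H : SimpleGraph (Fin (ℓ + 1 + (s - (m * D + r))))) (_ : DecidableRel H.Adj), H.CliqueFree 3 ∧
      H.edgeFinset.card = s ∧ ∃ w, deg H w + (m * D + r) = s ∧ (∀ v, offDeg H w v ≤ D) ∧
        (∃ x, ¬ H.Adj w x ∧ offDeg H w x = D) ∧
        ∃ j, ∑ v, deg H v * deg H v + 2 * ((m * D + r) * (s - (m * D + r) - 1)) + 2 * j = s * (s + 1) ∧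
          2 * j + 2 * ((m * D + r) * (D - 1)) =
            (m * D + r) * (m * D + r - 1) + 2 * (r * (D - 2 * r + 1))) := by
  have hmod : (m * D + r) % D = r := by
    rw [Nat.add_comm, Nat.add_mul_mod_self_right, Nat.mod_eq_of_lt (by omega)]
  constructor
  · intro H _ hfree hsH w hw hD' j hj
    have hw1 : 1 ≤ deg H w := by
      have : 0 < m * D := Nat.mul_pos (by omega) (by omega)
      omega
    have h := band_ge_residue_min H hfree s (m * D + r) j D hsH w hw hw1 hj hD' (by omega)
    rw [hmod, residue_min_half D r hr h2] at h
    exact h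
  · have ht : m * D + r = r + r * (D - 1) + (m - r) * D + r := by
      obtain ⟨D', rfl⟩ : ∃ D', D = D' + 1 := ⟨D - 1, by omega⟩
      obtain ⟨k, rfl⟩ : ∃ k, m = r + k := ⟨m - r, by omega⟩
      rw [Nat.add_sub_cancel, Nat.add_sub_cancel_left]
      ring
    have hinc : r * (D - 1) + (D - 1) * (D - r) + (m + 1 - D - r) * D = (m - r) * D + 0 := by
      obtain ⟨D', rfl⟩ : ∃ D', D = D' + 1 := ⟨D - 1, by omega⟩
      obtain ⟨c, rfl⟩ : ∃ c, D' = r + c := ⟨D' - r, by omega⟩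
      obtain ⟨E, rfl⟩ : ∃ E, m = r + c + r + E := ⟨m - (r + c) - r, by omega⟩
      have e1 : r + c + 1 - 1 = r + c := by omega
      have e2 : r + c + 1 - r = c + 1 := by omega
      have e3 : r + c + r + E + 1 - (r + c + 1) - r = E := by omega
      have e4 : r + c + r + E - r = r + c + E := by omega
      rw [e1, e2, e3, e4]
      ring
    obtain ⟨H, inst, hfree, hcard, w, hw, hD', hx, j, hj, hval⟩ :=
      starFamilyWitness s ℓ (m * D + r) D r r 0 (m + 1 - D - r) (m - r) ht hr hr (by omega) (by omega)
        (by omega) (by omega) (fun _ => by omega) hinc (by omega) hs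
    refine ⟨H, inst, hfree, hcard, w, hw, hD', hx, j, hj, ?_⟩
    rw [hval]
    obtain ⟨u, rfl⟩ : ∃ u, D = 2 * r + u := ⟨D - 2 * r, by omega⟩
    have e : 2 * r + u - (r + r) = u := by omega
    have e' : 2 * r + u - 2 * r = u := by omega
    rw [e, e', mul_zero, add_zero]
    ring

/-- **THE EXACT ELSE BOTTOM FOR `D < 2 r < 2 D` AND `m ≥ D + r − 2`, ALL GRAPHS, EVERY `ℓ`:** for
`D + 1 ≤ 2 r`, `r + 1 ≤ D`, `ρ = D − r`, `t = m D + r`, `D + r ≤ m + 2`, `m + 1 ≤ ℓ`, `2 t ≤ s`: every graph on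
`ℓ + 1 + (s − t)` vertices with a vertex of degree `s − t` and every off-degree `≤ D` has
`t (t − 1) + 2 ρ (D − 2 ρ + 1) ≤ 2 j + 2 t (D − 1)`, and the star family (with its short row) attains it with maximum
off-degree exactly `D` — the bottom is `C(t,2) − t (D − 1) + ρ (D − 2 ρ + 1)`. -/
theorem else_bottom_exact_upper (s ℓ m r D : ℕ) (h1 : D + 1 ≤ 2 * r) (h2 : r + 1 ≤ D) (hm : D + r ≤ m + 2)
    (hmℓ : m + 1 ≤ ℓ) (hs : 2 * (m * D + r) ≤ s) :
    (∀ (H : SimpleGraph (Fin (ℓ + 1 + (s - (m * D + r))))) [DecidableRel H.Adj], H.CliqueFree 3 →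
      H.edgeFinset.card = s → ∀ w, deg H w + (m * D + r) = s → (∀ v, offDeg H w v ≤ D) →
      ∀ j, ∑ v, deg H v * deg H v + 2 * ((m * D + r) * (s - (m * D + r) - 1)) + 2 * j = s * (s + 1) →
      (m * D + r) * (m * D + r - 1) + 2 * ((D - r) * (D - 2 * (D - r) + 1)) ≤
        2 * j + 2 * ((m * D + r) * (D - 1))) ∧
    (∃ (H : SimpleGraph (Fin (ℓ + 1 + (s - (m * D + r))))) (_ : DecidableRel H.Adj), H.CliqueFree 3 ∧
      H.edgeFinset.card = s ∧ ∃ w, deg H w + (m * D + r) = s ∧ (∀ v, offDeg H w v ≤ D) ∧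
        (∃ x, ¬ H.Adj w x ∧ offDeg H w x = D) ∧
        ∃ j, ∑ v, deg H v * deg H v + 2 * ((m * D + r) * (s - (m * D + r) - 1)) + 2 * j = s * (s + 1) ∧
          2 * j + 2 * ((m * D + r) * (D - 1)) =
            (m * D + r) * (m * D + r - 1) + 2 * ((D - r) * (D - 2 * (D - r) + 1))) := by
  have hmod : (m * D + r) % D = r := by
    rw [Nat.add_comm, Nat.add_mul_mod_self_right, Nat.mod_eq_of_lt (by omega)]
  constructor
  · intro H _ hfree hsH w hw hD' j hj
    have hw1 : 1 ≤ deg H w := by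
      have : 0 < m * D := Nat.mul_pos (by omega) (by omega)
      omega
    have h := band_ge_residue_min H hfree s (m * D + r) j D hsH w hw hw1 hj hD' (by omega)
    rw [hmod, residue_min_upper D r h1 h2] at h
    exact h
  · -- `D = 2 ρ + c`, `r = ρ + c`, `m = 3 ρ + 2 c − 2 + E` with `ρ, c ≥ 1`
    have ht : m * D + r = r + (D - r) * (D - 1) + (m - (D - r)) * D + (D - r) := by
      obtain ⟨ρ, rfl⟩ : ∃ ρ, D = r + ρ := ⟨D - r, by omega⟩
      obtain ⟨k, rfl⟩ : ∃ k, m = ρ + k := ⟨m - ρ, by omega⟩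
      obtain ⟨r', rfl⟩ : ∃ r', r = r' + 1 := ⟨r - 1, by omega⟩
      have e1 : r' + 1 + ρ - (r' + 1) = ρ := by omega
      have e2 : r' + 1 + ρ - 1 = r' + ρ := by omega
      have e3 : ρ + k - ρ = k := by omega
      rw [e1, e2, e3]
      ring
    have hinc : r * (D - 1) + (D - 1) * (D - (D - r)) + (m + 2 - D - r) * D =
        (m - (D - r)) * D + 2 * (D - r) := by
      obtain ⟨ρ', rfl⟩ : ∃ ρ', D = r + (ρ' + 1) := ⟨D - r - 1, by omega⟩
      obtain ⟨c', rfl⟩ : ∃ c', r = ρ' + 1 + (c' + 1) := ⟨r - ρ' - 2, by omega⟩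
      obtain ⟨E, rfl⟩ : ∃ E, m = 3 * ρ' + 2 * c' + 3 + E := ⟨m - (3 * ρ' + 2 * c' + 3), by omega⟩
      have e1 : ρ' + 1 + (c' + 1) + (ρ' + 1) - 1 = 2 * ρ' + c' + 2 := by omega
      have e2 : ρ' + 1 + (c' + 1) + (ρ' + 1) - (ρ' + 1 + (c' + 1)) = ρ' + 1 := by omega
      have e3 : ρ' + 1 + (c' + 1) + (ρ' + 1) - (ρ' + 1) = ρ' + c' + 2 := by omega
      have e4 : 3 * ρ' + 2 * c' + 3 + E + 2 - (ρ' + 1 + (c' + 1) + (ρ' + 1)) - (ρ' + 1 + (c' + 1)) = E := by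
        omega
      have e5 : 3 * ρ' + 2 * c' + 3 + E - (ρ' + 1) = 2 * ρ' + 2 * c' + 2 + E := by omega
      rw [e1, e2, e3, e4, e5]
      ring
    obtain ⟨H, inst, hfree, hcard, w, hw, hD', hx, j, hj, hval⟩ :=
      starFamilyWitness s ℓ (m * D + r) D (D - r) r (2 * (D - r)) (m + 2 - D - r) (m - (D - r)) ht (by omega)
        (by omega) (by omega) (by omega) (by omega) (by omega) (fun _ => by omega) hinc (by omega) hs
    refine ⟨H, inst, hfree, hcard, w, hw, hD', hx, j, hj, ?_⟩
    rw [hval]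
    obtain ⟨ρ, rfl⟩ : ∃ ρ, D = r + ρ := ⟨D - r, by omega⟩
    obtain ⟨c, rfl⟩ : ∃ c, r = ρ + c := ⟨r - ρ, by omega⟩
    have e1 : ρ + c + ρ - (ρ + c) = ρ := by omega
    have e2 : ρ + c + ρ - (ρ + c + ρ) = 0 := by omega
    have e3 : ρ + c + ρ - 2 * ρ = c := by omega
    rw [e1, e2, e3, mul_zero, zero_add]
    ring

end C047

end TriangleCap

end PercRepro
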